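import Literature.Computability.QuantumComplexity.ForrelationDerivativeTables
import HarnessLib

/-!
# Cross derivative Walsh tables: the PRODUCT of two 2-fold forrelations

Topic `Literature/Computability/QuantumComplexity` (family `quantum-advantage`; route
`QuantumAdvantage/CubicForrelation`, the signed items stmt-QuantumAdvantage-13931/13932/13933/14671).
Sequel to `ForrelationDerivativeTables.lean`; EVERYTHING here is a theorem (no named facts).

For real `f, f', g, g' : {0,1}ⁿ → ℝ` the **cross derivative Walsh table** of the pair `(f, f')` is
`X_{f,f'}(h,u) = ∑_x f(x) f'(x ⊕ h) (-1)^{u·x}` (`xdwt f f' h u`); `X_{f,f} = T_f` is the table `dwt f` of the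
prequel (`xdwt_self`). With `S(f,g) = ∑_{x,y} f(x) (-1)^{x·y} g(y)` (`fsum`, so that `Φ = S / 2^{3n/2}`):

* `sum_xdwt_mul_xdwt` : `∑_{h,u} X_{f,f'}(h,u) · X_{g',g}(u,h) = S(f,g) · S(f',g')` for ALL real data — the
  identity `∑ T_f T_gᵀ = S²` of the prequel "with two more letters" (reindex `h = x ⊕ x'`, `u = y ⊕ y'`);
  `sum_twist_mul_xdwt_mul_xdwt` is the same with the second table written `X_{g,g'}` and the character
  `(-1)^{h·u}` that the swap costs (`xdwt_swap`); `two_pow_mul_forrelation_mul` :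
  `2^{3n} · Φ(a,b) · Φ(a',b') = ∑_{h,u} X_{a,a'}(h,u) X_{b',b}(u,h)` for Boolean data read through `signOf`.
* `sum_xdwt_sq`, `sum_xdwt_sq_of_sq`, `sum_sum_xdwt_sq_of_sq` : row mass `∑_u X_{f,f'}(h,u)² = 4ⁿ` for every
  `h` and total mass `8ⁿ` when `f² = f'² = 1` — the length-squared law `X²/8ⁿ` is an exact probability.
* `xdwt_neg_left`, `xdwt_neg_neg` : `X_{-f,f'} = -X_{f,f'}`, `X_{-f,-f'} = X_{f,f'}` — the cross table sees
  ONE complementation and is blind to the joint one (the "parity principle" below).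

## Why it matters (prose; no complexity-class statement is formalised here)

For `f = (-1)^a`, `f' = (-1)^{a'}` with `a, a'` CUBIC, `x ↦ a(x) ⊕ a'(x ⊕ h) = D_h a(x) ⊕ (a ⊕ a')(x ⊕ h)`
is QUADRATIC as soon as `a ⊕ a'` is quadratic (and splits into `2^r` quadratic pieces on the cosets of a
codimension-`r` subspace when the cubic part of `a ⊕ a'` becomes quadratic after fixing `r` linear forms),
so every entry `X_{a,a'}(h,u)` is an exact quadratic Gauss sum (Dickson), exactly like `T_a(h,u)`. Sampling
`(h,u)` with probability `X_{a,a'}(h,u)²/8ⁿ` (`h` uniform, then `u` from the squared Walsh spectrum of a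
quadratic, which is flat on an explicit affine subspace) and averaging `Y = 8ⁿ X_{b',b}(u,h)/X_{a,a'}(h,u)`
gives an unbiased estimator of `2^{3n} Φ(a,b) Φ(a',b')` with `E[(Y/2^{3n})²] = 1`
(`sum_sum_xdwt_sq_of_sq`): the PRODUCT `Φ(a,b)·Φ(a',b')` — the relative sign, with magnitude — is
classically estimable to additive `ε` in `poly(n)/ε²` time across the whole class
`(a + RM(2,n)) × (b + RM(2,n))` (and, by importance sampling over the `2^r` pieces, across cubic differences
of rank `r = O(log n)` with second moment `≤ 2^{r+r'}`). Parity principle: every such statistic is invariant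
under `(a, a') ↦ (a ⊕ 1, a' ⊕ 1)` (`xdwt_neg_neg`), which flips BOTH forrelations, so the cross tables never
yield an absolute sign — at `k = 2`, degree `3`, a quantum computer contributes exactly one bit per such
class (the content of the route items `SignedCubicForrelationNotPrBPP` / `…InPrBPP`).

NOT here: the sampler and its `FP` witness (pattern: `CubicForrelationEstimatorMachine/Analysis.lean`), the
plateau structure of quadratic Walsh spectra (`QuadraticWalshGaussSum.lean`), Chebyshev.

## References

* [AaronsonAmbainis2018] S. Aaronson, A. Ambainis, Forrelation, SIAM J. Comput. 47 (2018), §1.1.1 (`Φ`),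
  §6 Thm 25–26 (cubic instances).
* [ODonnell2014] R. O'Donnell, Analysis of Boolean Functions (2014), §1.4 (characters, Parseval).
* E. Tang, A quantum-inspired classical algorithm for recommendation systems, STOC 2019 (length-squared
  sampling) — orientation for the estimator only.
-/

noncomputable section

namespace Literature.Computability.QuantumComplexity

namespace DerivativeWalsh

open Finset
open Literature.Computability.QuantumComplexity.BuzetChailloux
open Literature.Computability.QuantumComplexity.Simon (twist_mul_self twist_xor_left sum_twist)

variable {n : ℕ}

/-! ### The cross table and its symmetries -/

/-- The cross derivative Walsh table `X_{f,f'}(h,u) = ∑_x f(x) f'(x ⊕ h) (-1)^{u·x}` of a pair of real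
functions (for `f = (-1)^a`, `f' = (-1)^{a'}` with `a ⊕ a'` quadratic and `a` cubic this is the Walsh
coefficient at `u` of the QUADRATIC function `D_h a ⊕ (a ⊕ a')(· ⊕ h)`). [folklore] -/
def xdwt (f f' : (Fin n → Bool) → ℝ) (h u : Fin n → Bool) : ℝ :=
  ∑ x, f x * f' (bxor x h) * twist u x

/-- `X_{f,f} = T_f` (the derivative Walsh table of the prequel). [folklore] -/
theorem xdwt_self (f : (Fin n → Bool) → ℝ) : xdwt f f = dwt f := rfl

/-- Swapping the pair costs a character: `X_{f',f}(h,u) = (-1)^{u·h} X_{f,f'}(h,u)` (reindex `x ↦ x ⊕ h`).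
In particular `T_f(h,u) = 0` unless `u·h = 0`. [folklore] -/
theorem xdwt_swap (f f' : (Fin n → Bool) → ℝ) (h u : Fin n → Bool) :
    xdwt f' f h u = twist u h * xdwt f f' h u := by
  unfold xdwt
  rw [mul_sum, ← Equiv.sum_comp (bxorPerm h) (fun x => f' x * f (bxor x h) * twist u x)]
  refine sum_congr rfl fun x _ => ?_
  rw [bxorPerm_apply, bxor_comm h x, show bxor (bxor x h) h = x from by
      rw [bxor_comm (bxor x h) h, bxor_comm x h, bxor_bxor_cancel_left],
    twist_bxor_right]
  ring

/-- Negating the first function negates the cross table: `X_{-f,f'} = -X_{f,f'}` — unlike `T_f`, the cross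
table SEES a single complementation. [folklore] -/
theorem xdwt_neg_left (f f' : (Fin n → Bool) → ℝ) (h u : Fin n → Bool) :
    xdwt (fun x => -f x) f' h u = -xdwt f f' h u := by
  unfold xdwt
  rw [← sum_neg_distrib]
  exact sum_congr rfl fun x _ => by ring

/-- Negating the second function negates the cross table: `X_{f,-f'} = -X_{f,f'}`. [folklore] -/
theorem xdwt_neg_right (f f' : (Fin n → Bool) → ℝ) (h u : Fin n → Bool) :
    xdwt f (fun x => -f' x) h u = -xdwt f f' h u := by
  unfold xdwt
  rw [← sum_neg_distrib]
  exact sum_congr rfl fun x _ => by ring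

/-- **Parity principle**: the joint negation is invisible, `X_{-f,-f'} = X_{f,f'}`. Every statistic built
from cross tables of `((-1)^a, (-1)^{a'})` and `((-1)^{b'}, (-1)^b)` is therefore invariant under
`(a, a') ↦ (a ⊕ 1, a' ⊕ 1)`, which flips `Φ(a,b)` AND `Φ(a',b')`: cross tables carry relative signs only.
[folklore] -/
theorem xdwt_neg_neg (f f' : (Fin n → Bool) → ℝ) (h u : Fin n → Bool) :
    xdwt (fun x => -f x) (fun x => -f' x) h u = xdwt f f' h u := by
  rw [xdwt_neg_left, xdwt_neg_right, neg_neg]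

/-! ### The identity `∑_{h,u} X_{f,f'}(h,u) X_{g',g}(u,h) = S(f,g) S(f',g')` -/

/-- `∑_u (-1)^{u·x} X_{g',g}(u,h) = W_g(x) · ∑_y g'(y) (-1)^{y·x} (-1)^{h·y}`. [folklore] -/
theorem sum_twist_mul_xdwt (g' g : (Fin n → Bool) → ℝ) (x h : Fin n → Bool) :
    ∑ u, twist u x * xdwt g' g u h = W g x * ∑ y, g' y * twist y x * twist h y := by
  have step : ∀ u : Fin n → Bool,
      twist u x * xdwt g' g u h = ∑ y, g' y * twist h y * (g (bxor y u) * twist u x) := by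
    intro u
    unfold xdwt
    rw [mul_sum]
    exact sum_congr rfl fun y _ => by ring
  rw [sum_congr rfl fun u _ => step u, sum_comm, mul_sum]
  refine sum_congr rfl fun y _ => ?_
  rw [← mul_sum, sum_shift_twist g y x]
  ring

/-- Row form: `∑_u X_{f,f'}(h,u) X_{g',g}(u,h) = ∑_x f(x) f'(x⊕h) W_g(x) ∑_y g'(y) (-1)^{y·x} (-1)^{h·y}`.
[folklore] -/
theorem sum_xdwt_mul_xdwt_row (f f' g' g : (Fin n → Bool) → ℝ) (h : Fin n → Bool) :
    ∑ u, xdwt f f' h u * xdwt g' g u h =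
      ∑ x, f x * f' (bxor x h) * (W g x * ∑ y, g' y * twist y x * twist h y) := by
  have step : ∀ u : Fin n → Bool,
      xdwt f f' h u * xdwt g' g u h = ∑ x, f x * f' (bxor x h) * (twist u x * xdwt g' g u h) := by
    intro u
    rw [xdwt, sum_mul]
    exact sum_congr rfl fun x _ => by ring
  rw [sum_congr rfl fun u _ => step u, sum_comm]
  refine sum_congr rfl fun x _ => ?_
  rw [← mul_sum, sum_twist_mul_xdwt]

/-- **The cross identity.** For ALL real `f, f', g, g' : {0,1}ⁿ → ℝ`,
`∑_{h,u} X_{f,f'}(h,u) · X_{g',g}(u,h) = S(f,g) · S(f',g')`: the product of two forrelation sums is the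
transposed inner product of the two cross tables (reindex `h = x ⊕ x'`, `u = y ⊕ y'`; the characters
`(-1)^{x·y}` cancel). With `f = f'`, `g = g'` this is `sum_dwt_mul_dwt`. [folklore] -/
theorem sum_xdwt_mul_xdwt (f f' g g' : (Fin n → Bool) → ℝ) :
    ∑ h, ∑ u, xdwt f f' h u * xdwt g' g u h = fsum f g * fsum f' g' := by
  simp_rw [sum_xdwt_mul_xdwt_row]
  rw [sum_comm]
  have hx : ∀ x : Fin n → Bool,
      ∑ h, f x * f' (bxor x h) * (W g x * ∑ y, g' y * twist y x * twist h y) =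
        f x * W g x * ∑ y, g' y * W f' y := by
    intro x
    have e1 : ∀ h : Fin n → Bool, f x * f' (bxor x h) * (W g x * ∑ y, g' y * twist y x * twist h y) =
        ∑ y, f x * W g x * (g' y * twist y x) * (f' (bxor x h) * twist h y) := by
      intro h
      rw [mul_sum, mul_sum]
      exact sum_congr rfl fun y _ => by ring
    rw [sum_congr rfl fun h _ => e1 h, sum_comm, mul_sum]
    refine sum_congr rfl fun y _ => ?_
    rw [← mul_sum, sum_shift_twist f' x y]
    have := twist_mul_self x y
    rw [twist_comm y x]
    linear_combination (f x * W g x * g' y * W f' y) * this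
  rw [sum_congr rfl fun x _ => hx x, ← fsum_eq_sum_mul_W', ← sum_mul, ← fsum_eq_sum_mul_W]

/-- The same identity with both tables in "natural" order and the character the swap costs:
`∑_{h,u} (-1)^{h·u} X_{f,f'}(h,u) · X_{g,g'}(u,h) = S(f,g) · S(f',g')`. [folklore] -/
theorem sum_twist_mul_xdwt_mul_xdwt (f f' g g' : (Fin n → Bool) → ℝ) :
    ∑ h, ∑ u, twist h u * xdwt f f' h u * xdwt g g' u h = fsum f g * fsum f' g' := by
  rw [← sum_xdwt_mul_xdwt f f' g g']
  refine sum_congr rfl fun h _ => sum_congr rfl fun u _ => ?_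
  rw [xdwt_swap g g' u h]
  ring

/-- Boolean form: `2^{3n} · (Φ(a,b) · Φ(a',b')) = ∑_{h,u} X_{a,a'}(h,u) X_{b',b}(u,h)` with the data read
through `signOf`. With `a = a'`, `b = b'` this is `two_pow_mul_forrelation_sq`.
[cite: AaronsonAmbainis2018, §1.1.1] -/
theorem two_pow_mul_forrelation_mul (a a' b b' : (Fin n → Bool) → Bool) :
    (2 : ℝ) ^ (3 * n) * (forrelation a b * forrelation a' b') =
      ∑ h, ∑ u, xdwt (fun x => signOf (a x)) (fun x => signOf (a' x)) h u *
        xdwt (fun y => signOf (b' y)) (fun y => signOf (b y)) u h := by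
  rw [sum_xdwt_mul_xdwt, ← phi_signOf, ← phi_signOf, phi_eq_fsum, phi_eq_fsum]
  set r := Real.sqrt ((2 : ℝ) ^ (3 * n)) with hr
  set S₁ := fsum (fun x => signOf (a x)) (fun y => signOf (b y))
  set S₂ := fsum (fun x => signOf (a' x)) (fun y => signOf (b' y))
  have hs : r ^ 2 = 2 ^ (3 * n) := Real.sq_sqrt (by positivity)
  have hs0 : r ≠ 0 := Real.sqrt_ne_zero'.2 (by positivity)
  rw [← hs]
  calc r ^ 2 * (r⁻¹ * S₁ * (r⁻¹ * S₂)) = (r * r⁻¹) * (r * r⁻¹) * (S₁ * S₂) := by ring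
    _ = S₁ * S₂ := by rw [mul_inv_cancel₀ hs0]; ring

/-- **Relative signs.** If `Φ(a',b') > 0` then `Φ(a,b)` has the sign of the cross-table sum
`∑_{h,u} X_{a,a'}(h,u) X_{b',b}(u,h)`; stated as: the cross-table sum is positive iff the two forrelations
have the same strict sign (`Φ Φ' > 0`). [cite: AaronsonAmbainis2018, §1.1.1] -/
theorem sum_xdwt_mul_xdwt_pos_iff (a a' b b' : (Fin n → Bool) → Bool) :
    0 < ∑ h, ∑ u, xdwt (fun x => signOf (a x)) (fun x => signOf (a' x)) h u *
        xdwt (fun y => signOf (b' y)) (fun y => signOf (b y)) u h ↔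
      0 < forrelation a b * forrelation a' b' := by
  rw [← two_pow_mul_forrelation_mul]
  have h2 : (0 : ℝ) < 2 ^ (3 * n) := by positivity
  constructor
  · intro h
    by_contra hle
    have := mul_nonpos_of_nonneg_of_nonpos h2.le (not_lt.1 hle)
    linarith
  · intro h; positivity

/-! ### Row mass and total mass of the cross table -/

/-- **Row mass**: `∑_u X_{f,f'}(h,u)² = 2ⁿ ∑_x (f(x) f'(x⊕h))²` (Parseval for `x ↦ f(x) f'(x ⊕ h)`).
[cite: ODonnell2014, §1.4] -/
theorem sum_xdwt_sq (f f' : (Fin n → Bool) → ℝ) (h : Fin n → Bool) :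
    ∑ u, xdwt f f' h u ^ 2 = (2 : ℝ) ^ n * ∑ x, (f x * f' (bxor x h)) ^ 2 := by
  set F : (Fin n → Bool) → ℝ := fun x => f x * f' (bxor x h) with hF
  have hd : ∀ u, xdwt f f' h u = ∑ x, F x * twist u x := fun u => rfl
  have e1 : ∀ u : Fin n → Bool, xdwt f f' h u ^ 2 = ∑ x, ∑ x', F x * F x' * twist u (bxor x x') := by
    intro u
    rw [hd, sq, sum_mul_sum]
    refine sum_congr rfl fun x _ => sum_congr rfl fun x' _ => ?_
    rw [twist_bxor_right]
    ring
  rw [sum_congr rfl fun u _ => e1 u, sum_comm]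
  have e2 : ∀ x : Fin n → Bool,
      ∑ u, ∑ x', F x * F x' * twist u (bxor x x') = (2 : ℝ) ^ n * F x ^ 2 := by
    intro x
    rw [sum_comm]
    have e3 : ∀ x' : Fin n → Bool, ∑ u, F x * F x' * twist u (bxor x x') =
        F x * F x' * (if bxor x x' = zeroVec then (2 : ℝ) ^ n else 0) := by
      intro x'
      rw [← sum_twist_left, mul_sum]
    rw [sum_congr rfl fun x' _ => e3 x']
    simp_rw [bxor_eq_zeroVec_iff, mul_ite, mul_zero]
    rw [Finset.sum_ite_eq univ x, if_pos (mem_univ _)]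
    ring
  rw [sum_congr rfl fun x _ => e2 x, ← mul_sum]

/-- Row mass for `±1`-valued data: `∑_u X_{f,f'}(h,u)² = 4ⁿ` for EVERY `h` — the sampling law
`(h uniform, u ∝ X_{f,f'}(h,u)²)` is `X²/8ⁿ` exactly. [cite: ODonnell2014, §1.4] -/
theorem sum_xdwt_sq_of_sq (f f' : (Fin n → Bool) → ℝ) (hf : ∀ x, f x ^ 2 = 1)
    (hf' : ∀ x, f' x ^ 2 = 1) (h : Fin n → Bool) : ∑ u, xdwt f f' h u ^ 2 = (4 : ℝ) ^ n := by
  rw [sum_xdwt_sq]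
  simp_rw [mul_pow, hf, hf', mul_one, sum_const, card_univ, Fintype.card_fun, Fintype.card_bool,
    Fintype.card_fin, nsmul_eq_mul, mul_one]
  push_cast
  rw [← mul_pow]
  norm_num

/-- Total mass `‖X_{f,f'}‖² = ∑_{h,u} X_{f,f'}(h,u)² = 8ⁿ` for `±1`-valued data; for the estimator of the
module docstring this is `E[(Y/2^{3n})²] = 1`. [cite: ODonnell2014, §1.4] -/
theorem sum_sum_xdwt_sq_of_sq (f f' : (Fin n → Bool) → ℝ) (hf : ∀ x, f x ^ 2 = 1)
    (hf' : ∀ x, f' x ^ 2 = 1) : ∑ h, ∑ u, xdwt f f' h u ^ 2 = (8 : ℝ) ^ n := by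
  simp_rw [sum_xdwt_sq_of_sq f f' hf hf', sum_const, card_univ, Fintype.card_fun, Fintype.card_bool,
    Fintype.card_fin, nsmul_eq_mul]
  push_cast
  rw [← mul_pow]
  norm_num

/-- **Cauchy–Schwarz for the product**: `(S(f,g) S(f',g'))² ≤ 8ⁿ · 8ⁿ` for `±1`-valued data, recovering
`|Φ(a,b) Φ(a',b')| ≤ 1` from the cross identity and the two total masses (the shape of the estimator's
second-moment bound). [cite: ODonnell2014, §1.4] -/
theorem fsum_mul_fsum_sq_le (f f' g g' : (Fin n → Bool) → ℝ) (hf : ∀ x, f x ^ 2 = 1)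
    (hf' : ∀ x, f' x ^ 2 = 1) (hg : ∀ x, g x ^ 2 = 1) (hg' : ∀ x, g' x ^ 2 = 1) :
    (fsum f g * fsum f' g') ^ 2 ≤ (8 : ℝ) ^ n * (8 : ℝ) ^ n := by
  classical
  rw [← sum_xdwt_mul_xdwt, ← sum_product' (s := univ) (t := univ)
    (f := fun h u => xdwt f f' h u * xdwt g' g u h)]
  have hcs := sum_mul_sq_le_sq_mul_sq (univ ×ˢ univ) (fun p : (Fin n → Bool) × (Fin n → Bool) =>
    xdwt f f' p.1 p.2) (fun p => xdwt g' g p.2 p.1)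
  refine hcs.trans (le_of_eq ?_)
  rw [sum_product' (s := univ) (t := univ) (f := fun h u => xdwt f f' h u ^ 2),
    sum_product' (s := univ) (t := univ) (f := fun h u => xdwt g' g u h ^ 2),
    sum_sum_xdwt_sq_of_sq f f' hf hf', sum_comm, sum_sum_xdwt_sq_of_sq g' g hg' hg]

end DerivativeWalsh

end Literature.Computability.QuantumComplexity

end
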